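import Summits.QuantumFields.BalabanUV.Beta.FP.PerfectAsymptoticsBFCov

/-!
# `BalabanUV.Beta.FP.RemainderLedgerGen` — road «FP» for binder row D1, ROW KER-γ, RULING R-FP-40 row «E-COLS» (first refusal leaf-01 lineage, TAKEN CLAIMS
# 2026-08-21 l.28847, statement l.28858): THE γ-END WITH THE END COLUMNS ABSTRACT — `HorizontalRemainderPerfectCov.hbook∕hasym_perfect_of_remainder_cov`,
# `RemainderLedgerCov.hasym_perfect_of_pieces_cov` and the `PiBF` root `PerfectAsymptoticsBFCov.hasym_PiBF_of_pieces_of_cov` RE-TYPED over an ABSTRACT packed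
# family `Kp : ℕ → MKer (3+1) (Fib 3)` whose END columns `colOf (Kp m)` carry the four m-UNIFORM transport letters (L0)(L1)(LE) AS HYPOTHESES (in the tree they
# are `PerfectColumnTransportTail.transportLetters_perfCol` at `KPerf … m`, the AXIAL placement; at the literal of record R-FP-40 (R40-a) the columns are those of
# the co-dressed perfect kernel `G^s_m` — row COL-SYM supplies the letters there)

HONEST DEPENDENCY (page 1, mandatory): continuum YM on T⁴ ⇐ BetaPertH ∧ nine spine estimates (0/9 proved); BetaPertH ⇐ (D1) ∧ (D4) ∧
CAP+tail; G-an2-4 gates asym, D1 and NE2/3/4.  HONEST FRAMING (cell contract, verbatim): «discharging `BetaPertH` makes Bałaban's UV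
stability UNCONDITIONAL — a real constructive-QFT result; it is NOT the continuum limit and NOT the Clay problem.»  THIS MODULE is [our object]∕[folklore]
COMPOSITION BY NAME: the bodies of the three tree theorems verbatim, the one call `transportLetters_perfCol` replaced by the displayed letters (the letter-level END
`HorizontalRemainderPerfectCov.end_of_remainder_expL1_cov` is already generic in the weights).  No `def`, no `def … : Prop`, nothing cited, nothing of the manuscripts
under audit asserted, 0 sorry; no existing file touched.  NOT COL-SYM (the letters for `colOf (G^s_m)`), NOT hsplit, NOT (ASYMP) for the literal, NOT D1; 0∕4 row-D1
binders; NOT BetaPertH, NOT continuum, NOT Clay.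

ABSOLUTE RULE (cell charter, verbatim): «No internally-minted statement may enter as a cited fact. Every hypothesis is either kernel-proved in this
package or a verbatim quotation of a PUBLISHED theorem with page reference. The manuscript(s) under audit are NOT citable for their own disputed
steps — they are the thing under adjudication; programme-internal (2001/route/tribunal) claims are never citable.»

THE DISPLAYED COLUMN LETTERS (per `m ≥ 1`, `N := Lc^m`, ONE pair `(δc, cc)` for all m — VERBATIM the `hw0 hw1 hwE hwEb` of `end_of_remainder_expL1_cov`):
(L0) `ConstReproSum N (colOf (Kp m) κ l) (if κ = l then (N^(4+1))⁻¹ else 0)`; (L1) `∃ Cw, ∀ κ l, LinReproSum N (colOf (Kp m) κ l) (Cw κ l)`;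
(LE) `Summable (x ↦ exp((δc∕N)·|x|₁)·|colOf (Kp m) κ l x|)` and `Σ′_x exp((δc∕N)·|x|₁)·|colOf (Kp m) κ l x| ≤ cc∕N`.

CONTENT.
* §1 [our object] **`hbook_of_remainder_cov_gen`**, **`hasym_of_remainder_cov_gen`**, **`hasym_of_pieces_cov_gen`**; consistency `example` (the tree END
  `RemainderLedgerCov.hasym_perfect_of_pieces_cov` recovered from `transportLetters_perfCol`, one `obtain`).
* §2 [our object] **`hasym_PiBF_of_pieces_gen`** — the γ-END capstone at `K := PiBF` with (K6)(K0)(hgerm) discharged, (Kcov) abstract (R-FP-39), columns abstract.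
Provenance: D1 formalisation swarm LEAF PROVER 01, unit `b2b-balaban-beta-d1-formalise-leaf-01` gen 12, 2026-08-21, road FP row E-COLS (R-FP-40).
-/

noncomputable section

namespace Summit.QuantumFields.BalabanUV.Beta.FP.RemainderLedgerGen

open Finset Filter Topology
open scoped BigOperators
open Literature.Probability.LatticeModels (box annulus)
open Literature.MathematicalPhysics.QuantumFieldTheory.Balaban1983to89
open Literature.MathematicalPhysics.QuantumFieldTheory.Balaban1983to89.Beta
open Literature.MathematicalPhysics.QuantumFieldTheory.Balaban1983to89.Beta.BubbleTransfer (c4)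
open Literature.MathematicalPhysics.QuantumFieldTheory.Balaban1983to89.B12Normalization (stepBal stepBal_eq)
open B12Sec2to5 (l1)
open PolarizationSign (AxisReflectionCovariant reflSign)
open ExpKernelCalculus (Site MKer BiLoc comp shiftK)
open OneStepResolventKernel (Fib LocStencil)
open OneStepKernelFamily (flipK)
open KernelWard (divV divW)
open KernelReflection (LegMap refK bondRefl)
open DyadicShell (Pt supNorm)
open DecimatedMomentSummable (ConstReproSum LinReproSum AbsMoment₂)
open DressedMomentNormalisation (EKer dressedEntry)
open LeadingCoefficient (kappaBal)
open Summit.QuantumFields.BalabanUV.Beta.GAN24.CombesThomas (sfStep smStep)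
open Summit.QuantumFields.BalabanUV.Beta.FP.PerfectObjectsT (KPerf)
open Summit.QuantumFields.BalabanUV.Beta.FP.TransportInfinityM (colOf)
open Summit.QuantumFields.BalabanUV.Beta.FP.HorizontalBookkeeping (truncK)
open Summit.QuantumFields.BalabanUV.Beta.FP.HorizontalBookkeepingTail (nonneg_of_decay)
open Summit.QuantumFields.BalabanUV.Beta.FP.HorizontalRemainderPerfectCov (end_of_remainder_expL1_cov)
open Summit.QuantumFields.BalabanUV.Beta.FP.HorizontalEndNat (hasym_of_horizontal_nat)
open Summit.QuantumFields.BalabanUV.Beta.FP.PerfectColumnTransportTail (transportLetters_perfCol)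
open Summit.QuantumFields.BalabanUV.Beta.FP.RemainderLedger (rem_of_split)
open Summit.QuantumFields.BalabanUV.Beta.FP.WilsonCubicGerm (cubicGermOf)
open Summit.QuantumFields.BalabanUV.Beta.FP.GhostCubicGerm (cubicGermOfSc)
open Summit.QuantumFields.BalabanUV.Beta.FP.BubbleGermValue (bfGerm ghostGerm)
open Summit.QuantumFields.BalabanUV.Beta.FP.PerfectPolarization (Pker G0ker PiBF)
open Summit.QuantumFields.BalabanUV.Beta.FP.PerfectPolarizationGerm (hgerm_PiBF)
open Summit.QuantumFields.BalabanUV.Beta.FP.PerfectPolarizationDecay (sextic_PiBF)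
open Summit.QuantumFields.BalabanUV.Beta.FP.PerfectPolarizationZerothMoment (hK0_PiBF)

section Gen

variable {Lc : ℕ} [NeZero Lc]

/-! ## §1 `hbook` ∕ `hasym` ∕ the piece form, with the END columns abstract -/

/-- **`hbook` FROM THREE KERNEL LETTERS, THE REMAINDER LETTER AND THE DISPLAYED COLUMN LETTERS** [our object] (`d = 3`, any `Lc ≠ 0`):
`HorizontalRemainderPerfectCov.hbook_perfect_of_remainder_cov` with the perfect columns `colOf (KPerf…m)` REPLACED by `colOf (Kp m)` of an abstract packed family
carrying (L0)(L1)(LE) m-uniformly — `U₀` is the same displayed polynomial in `(C, cc, δc)`. -/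
theorem hbook_of_remainder_cov_gen {K : EKer 4} {C : ℝ}
    (hK : ∀ c' e (t : Pt), |K c' e t| ≤ C / ((supNorm t : ℝ) + 1) ^ 6)
    (hcov : AxisReflectionCovariant (flipK K)) (hK0 : ∀ c' e, HasSum (K c' e) 0)
    {Kp : ℕ → MKer (3 + 1) (Fib 3)} {δc cc : ℝ} (hδc : 0 < δc) (hcc : 0 ≤ cc)
    (hw0 : ∀ m : ℕ, 1 ≤ m → ∀ κ l, ConstReproSum (Lc ^ m) (colOf (Kp m) κ l)
      (if κ = l then ((((Lc ^ m : ℕ) : ℝ) ^ (4 + 1))⁻¹) else 0))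
    (hw1 : ∀ m : ℕ, 1 ≤ m → ∃ Cw : Fin 4 → Fin 4 → Fin 4 → ℝ, ∀ κ l, LinReproSum (Lc ^ m) (colOf (Kp m) κ l) (Cw κ l))
    (hwE : ∀ m : ℕ, 1 ≤ m → ∀ κ l, Summable fun x : Pt => Real.exp (δc / ((Lc ^ m : ℕ) : ℝ) * l1 x) * |colOf (Kp m) κ l x|)
    (hwEb : ∀ m : ℕ, 1 ≤ m → ∀ κ l,
      ∑' x : Pt, Real.exp (δc / ((Lc ^ m : ℕ) : ℝ) * l1 x) * |colOf (Kp m) κ l x| ≤ cc / ((Lc ^ m : ℕ) : ℝ))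
    {T : ℕ → Fin 4 → Fin 4 → Pt → ℝ} (μ ν : Fin 4) {Bρ : ℝ}
    (hrem : ∀ m : ℕ, 1 ≤ m → ∀ S : Finset Pt, ∑ v ∈ S, (supNorm v : ℝ) ^ 2 *
      |T m μ ν v - ((Lc ^ m : ℕ) : ℝ) ^ 8 * dressedEntry (colOf (Kp m)) (truncK K (Lc ^ m)) (((Lc ^ m : ℕ) : ℤ) • v) μ ν| ≤ Bρ) :
    ∃ U₀ : ℝ, 0 ≤ U₀ ∧ ∀ m : ℕ, 1 ≤ m →
      (Summable fun v : Pt => T m μ ν v * (v μ : ℝ) * (v ν : ℝ)) ∧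
      |B12Beta.secondMoment (T m) μ ν - ∑ z ∈ annulus 4 0 (Lc ^ m), K μ ν z * (z μ : ℝ) * (z ν : ℝ)| ≤ U₀ + Bρ := by
  have hC : 0 ≤ C := nonneg_of_decay hK μ ν
  refine ⟨16 * (40 * C) * (2 * (2 * cc * Real.exp δc / δc ^ 2) + 2 * (cc * Real.exp δc / δc) * (cc * Real.exp δc / δc))
      + 64 * (80 * C) * (cc * Real.exp δc / δc), by positivity, fun m hm => ?_⟩
  obtain ⟨Cw, hw1m⟩ := hw1 m hm
  have hN : 1 ≤ Lc ^ m := Nat.one_le_pow m Lc (Nat.pos_of_ne_zero (NeZero.ne Lc))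
  exact end_of_remainder_expL1_cov hN hδc hK hcov hK0 Cw (hw0 m hm) hw1m (hwE m hm) (hwEb m hm) μ ν (hrem m hm)

/-- **`hasym` WITH THE END COLUMNS ABSTRACT** [our object]: `hbook_of_remainder_cov_gen` plus the windowed germ letter `hgerm` give an m-FREE `U₀ ≥ 0` with
`|secondMoment (T m) μ ν − m·(s·log Lc)| ≤ (U₀ + Bρ) + Cg + |c₀|` for every `m ≥ 1`. -/
theorem hasym_of_remainder_cov_gen (hLc : 2 ≤ Lc) {K : EKer 4} {C : ℝ}
    (hK : ∀ c' e (t : Pt), |K c' e t| ≤ C / ((supNorm t : ℝ) + 1) ^ 6)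
    (hcov : AxisReflectionCovariant (flipK K)) (hK0 : ∀ c' e, HasSum (K c' e) 0)
    {Kp : ℕ → MKer (3 + 1) (Fib 3)} {δc cc : ℝ} (hδc : 0 < δc) (hcc : 0 ≤ cc)
    (hw0 : ∀ m : ℕ, 1 ≤ m → ∀ κ l, ConstReproSum (Lc ^ m) (colOf (Kp m) κ l)
      (if κ = l then ((((Lc ^ m : ℕ) : ℝ) ^ (4 + 1))⁻¹) else 0))
    (hw1 : ∀ m : ℕ, 1 ≤ m → ∃ Cw : Fin 4 → Fin 4 → Fin 4 → ℝ, ∀ κ l, LinReproSum (Lc ^ m) (colOf (Kp m) κ l) (Cw κ l))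
    (hwE : ∀ m : ℕ, 1 ≤ m → ∀ κ l, Summable fun x : Pt => Real.exp (δc / ((Lc ^ m : ℕ) : ℝ) * l1 x) * |colOf (Kp m) κ l x|)
    (hwEb : ∀ m : ℕ, 1 ≤ m → ∀ κ l,
      ∑' x : Pt, Real.exp (δc / ((Lc ^ m : ℕ) : ℝ) * l1 x) * |colOf (Kp m) κ l x| ≤ cc / ((Lc ^ m : ℕ) : ℝ))
    {T : ℕ → Fin 4 → Fin 4 → Pt → ℝ} (μ ν : Fin 4) {Bρ : ℝ}
    (hrem : ∀ m : ℕ, 1 ≤ m → ∀ S : Finset Pt, ∑ v ∈ S, (supNorm v : ℝ) ^ 2 *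
      |T m μ ν v - ((Lc ^ m : ℕ) : ℝ) ^ 8 * dressedEntry (colOf (Kp m)) (truncK K (Lc ^ m)) (((Lc ^ m : ℕ) : ℤ) • v) μ ν| ≤ Bρ)
    {s c₀ Cg : ℝ}
    (hgerm : ∀ M : ℕ, 1 ≤ M → |∑ z ∈ annulus 4 0 M, K μ ν z * (z μ : ℝ) * (z ν : ℝ) - (s * Real.log M + c₀)| ≤ Cg) :
    ∃ U₀ : ℝ, 0 ≤ U₀ ∧ ∀ m : ℕ, 1 ≤ m →
      |B12Beta.secondMoment (T m) μ ν - (m : ℝ) * (s * Real.log Lc)| ≤ (U₀ + Bρ) + Cg + |c₀| := by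
  obtain ⟨U₀, hU₀, hbook⟩ := hbook_of_remainder_cov_gen (Lc := Lc) hK hcov hK0 hδc hcc hw0 hw1 hwE hwEb (T := T) μ ν hrem
  have hLc1 : 1 ≤ Lc := le_trans (by norm_num) hLc
  exact ⟨U₀, hU₀, hasym_of_horizontal_nat (f := fun m => B12Beta.secondMoment (T m) μ ν)
    (g := fun M => ∑ z ∈ annulus 4 0 M, K μ ν z * (z μ : ℝ) * (z ν : ℝ)) hLc1 (fun m hm => (hbook m hm).2) hgerm⟩

/-- **`hasym` FROM A SPLIT INTO PIECES, END COLUMNS ABSTRACT** [our object] (`RemainderLedgerCov.hasym_perfect_of_pieces_cov` twin; `rem_of_split` BY NAME). -/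
theorem hasym_of_pieces_cov_gen (hLc : 2 ≤ Lc) {K : EKer 4} {C : ℝ}
    (hK : ∀ c' e (t : Pt), |K c' e t| ≤ C / ((supNorm t : ℝ) + 1) ^ 6)
    (hcov : AxisReflectionCovariant (flipK K)) (hK0 : ∀ c' e, HasSum (K c' e) 0)
    {Kp : ℕ → MKer (3 + 1) (Fib 3)} {δc cc : ℝ} (hδc : 0 < δc) (hcc : 0 ≤ cc)
    (hw0 : ∀ m : ℕ, 1 ≤ m → ∀ κ l, ConstReproSum (Lc ^ m) (colOf (Kp m) κ l)
      (if κ = l then ((((Lc ^ m : ℕ) : ℝ) ^ (4 + 1))⁻¹) else 0))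
    (hw1 : ∀ m : ℕ, 1 ≤ m → ∃ Cw : Fin 4 → Fin 4 → Fin 4 → ℝ, ∀ κ l, LinReproSum (Lc ^ m) (colOf (Kp m) κ l) (Cw κ l))
    (hwE : ∀ m : ℕ, 1 ≤ m → ∀ κ l, Summable fun x : Pt => Real.exp (δc / ((Lc ^ m : ℕ) : ℝ) * l1 x) * |colOf (Kp m) κ l x|)
    (hwEb : ∀ m : ℕ, 1 ≤ m → ∀ κ l,
      ∑' x : Pt, Real.exp (δc / ((Lc ^ m : ℕ) : ℝ) * l1 x) * |colOf (Kp m) κ l x| ≤ cc / ((Lc ^ m : ℕ) : ℝ))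
    {T : ℕ → Fin 4 → Fin 4 → Pt → ℝ} (μ ν : Fin 4) {ι : Type*} (I : Finset ι) {D : ι → ℕ → Pt → ℝ} {B : ι → ℝ}
    (hsplit : ∀ m : ℕ, 1 ≤ m → ∀ v : Pt,
      T m μ ν v - ((Lc ^ m : ℕ) : ℝ) ^ 8 * dressedEntry (colOf (Kp m)) (truncK K (Lc ^ m)) (((Lc ^ m : ℕ) : ℤ) • v) μ ν = ∑ i ∈ I, D i m v)
    (hpieces : ∀ i ∈ I, ∀ m : ℕ, 1 ≤ m → ∀ S : Finset Pt, ∑ v ∈ S, (supNorm v : ℝ) ^ 2 * |D i m v| ≤ B i)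
    {s c₀ Cg : ℝ}
    (hgerm : ∀ M : ℕ, 1 ≤ M → |∑ z ∈ annulus 4 0 M, K μ ν z * (z μ : ℝ) * (z ν : ℝ) - (s * Real.log M + c₀)| ≤ Cg) :
    ∃ U₀ : ℝ, 0 ≤ U₀ ∧ ∀ m : ℕ, 1 ≤ m →
      |B12Beta.secondMoment (T m) μ ν - (m : ℝ) * (s * Real.log Lc)| ≤ (U₀ + ∑ i ∈ I, B i) + Cg + |c₀| :=
  hasym_of_remainder_cov_gen hLc hK hcov hK0 hδc hcc hw0 hw1 hwE hwEb (T := T) μ ν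
    (fun m hm => rem_of_split (T := T m) I (hsplit m hm) (fun i hi => hpieces i hi m hm)) hgerm

/-- [our object] CONSISTENCY (an `example`, since the statement IS the tree's `RemainderLedgerCov.hasym_perfect_of_pieces_cov` — the gate's dedup rule forbids
re-declaring it): the tree END is the instance `Kp m := KPerf … m` of `hasym_of_pieces_cov_gen` with the letters of `transportLetters_perfCol` (one `obtain`). -/
example (hLc : 2 ≤ Lc) {K : EKer 4} {C : ℝ}
    (hK : ∀ c' e (t : Pt), |K c' e t| ≤ C / ((supNorm t : ℝ) + 1) ^ 6)
    (hcov : AxisReflectionCovariant (flipK K)) (hK0 : ∀ c' e, HasSum (K c' e) 0)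
    {T : ℕ → Fin 4 → Fin 4 → Pt → ℝ} (μ ν : Fin 4) {ι : Type*} (I : Finset ι) {D : ι → ℕ → Pt → ℝ} {B : ι → ℝ}
    (hsplit : ∀ m : ℕ, 1 ≤ m → ∀ v : Pt,
      T m μ ν v - ((Lc ^ m : ℕ) : ℝ) ^ 8 * dressedEntry (colOf (KPerf (d := 3) Lc (sfStep Lc) (smStep 3 Lc) m))
          (truncK K (Lc ^ m)) (((Lc ^ m : ℕ) : ℤ) • v) μ ν = ∑ i ∈ I, D i m v)
    (hpieces : ∀ i ∈ I, ∀ m : ℕ, 1 ≤ m → ∀ S : Finset Pt, ∑ v ∈ S, (supNorm v : ℝ) ^ 2 * |D i m v| ≤ B i)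
    {s c₀ Cg : ℝ}
    (hgerm : ∀ M : ℕ, 1 ≤ M → |∑ z ∈ annulus 4 0 M, K μ ν z * (z μ : ℝ) * (z ν : ℝ) - (s * Real.log M + c₀)| ≤ Cg) :
    ∃ U₀ : ℝ, 0 ≤ U₀ ∧ ∀ m : ℕ, 1 ≤ m →
      |B12Beta.secondMoment (T m) μ ν - (m : ℝ) * (s * Real.log Lc)| ≤ (U₀ + ∑ i ∈ I, B i) + Cg + |c₀| := by
  obtain ⟨δ, c, hδ, hc, hL⟩ := transportLetters_perfCol (Lc := Lc) hLc
  exact hasym_of_pieces_cov_gen (Kp := fun m => KPerf (d := 3) Lc (sfStep Lc) (smStep 3 Lc) m) hLc hK hcov hK0 hδ hc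
    (fun m hm => (hL m hm).1) (fun m hm => (hL m hm).2.1) (fun m hm => (hL m hm).2.2.2.1) (fun m hm => (hL m hm).2.2.2.2)
    (T := T) μ ν I hsplit hpieces hgerm

end Gen

/-! ## §2 The `PiBF` root with the END columns abstract -/

/-- **(ASYMP) AT THE EXPLICIT KERNEL `PiBF`, MODULO `hsplit`, THE PIECE LEDGER, THE REFLECTION LETTER AND THE COLUMN LETTERS** [our object]:
`PerfectAsymptoticsBFCov.hasym_PiBF_of_pieces_of_cov` with the END columns `colOf (KPerf…m)` REPLACED by `colOf (Kp m)` of an abstract packed family carrying (L0)(L1)(LE). -/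
theorem hasym_PiBF_of_pieces_gen {Lc : ℕ} [NeZero Lc] (hLc : 2 ≤ Lc) (wg wgh : ℝ)
    {V : Fin 4 → Site 4 → MKer 4 (Fib 3)} {W : Fin 4 → Site 4 → Fin 4 → Site 4 → MKer 4 (Fib 3)}
    {v : Fin 4 → Site 4 → MKer 4 Unit} {w : Fin 4 → Site 4 → Fin 4 → Site 4 → MKer 4 Unit} {Cv Cw Cx Cw' Cx' CwL CwL' cQ δ : ℝ} (hδ : 0 < δ)
    -- admissible-family letters, gluon sector
    (hV : ∀ (μ : Fin 4) (y : Site 4), BiLoc (V μ y) y y Cv δ) (hW : ∀ (μ : Fin 4) (y : Site 4) (ν : Fin 4) (y' : Site 4), BiLoc (W μ y ν y') y y' Cw δ)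
    (hcovV : ∀ (μ : Fin 4) (y t : Site 4), V μ (y + t) = shiftK (-t) (V μ y))
    (hcovW : ∀ (μ : Fin 4) (y : Site 4) (ν : Fin 4) (y' t : Site 4), W μ (y + t) ν (y' + t) = shiftK (-t) (W μ y ν y'))
    (X : Site 4 → MKer 4 (Fib 3)) (hX : ∀ y, BiLoc (X y) y y Cx δ)
    (hW1 : ∀ y, comp (comp Pker (divV V y)) Pker = comp Pker (X y) - comp (X y) Pker)
    (hW2 : ∀ y ν y', divW W y ν y' = comp (X y) (V ν y') - comp (V ν y') (X y))
    (hKcov : AxisReflectionCovariant (flipK (PiBF wg wgh V W v w)))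
    (h0V : ∀ (lam α β : Fin 4), ∑' p : Pt × Pt, V lam 0 p.1 p.2 (Sum.inl α) (Sum.inl β) = 0)
    (hgermV : cubicGermOf V = cQ • bfGerm)
    (hWloc : ∀ (μ ν : Fin 4) (z : Pt), BiLoc (W μ 0 ν z) 0 z (CwL * Real.exp (-δ * l1 z)) δ)
    -- admissible-family letters, ghost sector
    (hv : ∀ (μ : Fin 4) (y : Site 4), BiLoc (v μ y) y y Cv δ) (hw : ∀ (μ : Fin 4) (y : Site 4) (ν : Fin 4) (y' : Site 4), BiLoc (w μ y ν y') y y' Cw' δ)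
    (hcovv : ∀ (μ : Fin 4) (y t : Site 4), v μ (y + t) = shiftK (-t) (v μ y))
    (hcovw : ∀ (μ : Fin 4) (y : Site 4) (ν : Fin 4) (y' t : Site 4), w μ (y + t) ν (y' + t) = shiftK (-t) (w μ y ν y'))
    (Xg : Site 4 → MKer 4 Unit) (hXg : ∀ y, BiLoc (Xg y) y y Cx' δ)
    (hW1g : ∀ y, comp (comp G0ker (divV v y)) G0ker = comp G0ker (Xg y) - comp (Xg y) G0ker)
    (hW2g : ∀ y ν y', divW w y ν y' = comp (Xg y) (v ν y') - comp (v ν y') (Xg y))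
    (h0v : ∀ lam : Fin 4, ∑' p : Pt × Pt, v lam 0 p.1 p.2 () () = 0)
    (hgermv : cubicGermOfSc v = ghostGerm)
    (hwloc : ∀ (μ ν : Fin 4) (z : Pt), BiLoc (w μ 0 ν z) 0 z (CwL' * Real.exp (-δ * l1 z)) δ)
    -- the colour weights and the entry
    {N : ℝ} (hn : (40 * wg * (1 / 4 : ℝ) * (c4 * cQ) ^ 2 - wgh * (-(1 / 2 : ℝ)) * c4 ^ 2) / 3 = kappaBal N)
    {μ ν : Fin 4} (hμν : μ ≠ ν)
    -- THE ABSTRACT END COLUMNS: a packed family `Kp m` with the m-UNIFORM transport letters (L0)(L1)(LE) of `colOf (Kp m)`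
    {Kp : ℕ → MKer (3 + 1) (Fib 3)} {δc cc : ℝ} (hδc : 0 < δc) (hcc : 0 ≤ cc)
    (hw0 : ∀ m : ℕ, 1 ≤ m → ∀ κ l, ConstReproSum (Lc ^ m) (colOf (Kp m) κ l)
      (if κ = l then ((((Lc ^ m : ℕ) : ℝ) ^ (4 + 1))⁻¹) else 0))
    (hw1 : ∀ m : ℕ, 1 ≤ m → ∃ Cw : Fin 4 → Fin 4 → Fin 4 → ℝ, ∀ κ l, LinReproSum (Lc ^ m) (colOf (Kp m) κ l) (Cw κ l))
    (hwE : ∀ m : ℕ, 1 ≤ m → ∀ κ l, Summable fun x : Pt => Real.exp (δc / ((Lc ^ m : ℕ) : ℝ) * l1 x) * |colOf (Kp m) κ l x|)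
    (hwEb : ∀ m : ℕ, 1 ≤ m → ∀ κ l,
      ∑' x : Pt, Real.exp (δc / ((Lc ^ m : ℕ) : ℝ) * l1 x) * |colOf (Kp m) κ l x| ≤ cc / ((Lc ^ m : ℕ) : ℝ))
    -- the split against the dressed truncated transport of `PiBF` BY THOSE COLUMNS, and the piece ledger
    {T : ℕ → Fin 4 → Fin 4 → Pt → ℝ} {ι : Type*} (I : Finset ι) {D : ι → ℕ → Pt → ℝ} {B : ι → ℝ}
    (hsplit : ∀ m : ℕ, 1 ≤ m → ∀ u : Pt,
      T m μ ν u - ((Lc ^ m : ℕ) : ℝ) ^ 8 * dressedEntry (colOf (Kp m))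
          (truncK (PiBF wg wgh V W v w) (Lc ^ m)) (((Lc ^ m : ℕ) : ℤ) • u) μ ν = ∑ i ∈ I, D i m u)
    (hpieces : ∀ i ∈ I, ∀ m : ℕ, 1 ≤ m → ∀ S : Finset Pt, ∑ u ∈ S, (supNorm u : ℝ) ^ 2 * |D i m u| ≤ B i) :
    ∃ U₀ : ℝ, 0 ≤ U₀ ∧ ∃ Cg : ℝ, ∀ m : ℕ, 1 ≤ m →
      |B12Beta.secondMoment (T m) μ ν - (m : ℝ) * stepBal N Lc| ≤ (U₀ + ∑ i ∈ I, B i) + Cg := by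
  -- module C's engine shapes of the cubic letters
  have hLoc : LocStencil V Cv δ := fun κ u => hV κ u
  have hcovV0 : ∀ (lam : Fin 4) (u : Site 4), V lam u = shiftK (-u) (V lam 0) := fun lam u => by
    have h := hcovV lam 0 u; rwa [zero_add] at h
  have hcovv0 : ∀ (lam : Fin 4) (u : Site 4), v lam u = shiftK (-u) (v lam 0) := fun lam u => by
    have h := hcovv lam 0 u; rwa [zero_add] at h
  -- the four K-letters at `K := PiBF`
  obtain ⟨C, _, hK⟩ := sextic_PiBF (wg := wg) (wgh := wgh) (cQ := cQ) hδ hLoc hcovV0 h0V hgermV hWloc hv hcovv0 h0v hgermv hwloc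
  have hK0 : ∀ c e, HasSum (PiBF wg wgh V W v w c e) 0 :=
    hK0_PiBF wg wgh hδ hV hW hcovV hcovW X hX hW1 hW2 hv hw hcovv hcovw Xg hXg hW1g hW2g h0V hgermV hWloc h0v hgermv hwloc
  obtain ⟨Cg, hgerm⟩ := hgerm_PiBF (wg := wg) (wgh := wgh) (cQ := cQ) hδ hLoc hcovV0 h0V hgermV hWloc hv hcovv0 h0v hgermv hwloc hn hμν
  -- the cov re-cut END
  obtain ⟨U₀, hU₀, hasym⟩ := hasym_of_pieces_cov_gen hLc hK hKcov hK0 hδc hcc hw0 hw1 hwE hwEb (T := T) μ ν I hsplit hpieces hgerm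
  refine ⟨U₀, hU₀, Cg, fun m hm => ?_⟩
  have h := hasym m hm
  rw [stepBal_eq]
  simpa using h

end Summit.QuantumFields.BalabanUV.Beta.FP.RemainderLedgerGen

end
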